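import Summits.Ventures.PercRepro.RankLevelSetHallLevelOneArith
import Summits.Ventures.PercRepro.RankLevelSetRuleQRhat
import Summits.Ventures.PercRepro.RankLevelSetHallLevel

/-!
# PercRepro — THE FIRST LEVEL OF THE LEVEL-WISE LYM FORM IS A THEOREM AT THE TIGHT LAYER (night-1, gen 23)

Night-2's level-wise shadow form `ShadowC025Level` (= `LevelHallUpC025` in the C-044 vocabulary) at its FIRST level
`t = q + 1`, for EVERY finite matroid at the tight layer `#E = p + q`, `q + 2 ≤ p`: for every subfamily `𝒜` of members,
`C(p+q, q+1)·#𝒜 ≤ C(p+q, q)·#{S ∈ upNbhd 𝒜 : r(S) = q + 1}`.  THE MECHANISM: Rule Q's equal split pays the first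
level — its level-`(q+1)` receipt `recv_{q+1}(Z) = Σ_{S ∈ Y, Z ⊆ S, r S = q+1} 1/m(S)` is at least
`(p − m)·S_1(q, m)` (`m = #flatPart Z`, `S_1 = sliceS q m 1`): the sets `Z ∪ X_P ∪ {d}` (`X_P ⊆ flatPart Z`,
`d ∈ freePart Z`) are distinct sets of rank exactly `q + 1` above `Z`, each with at most `C(q + #X_P + 1, q)` members
inside (`memCount_le_choose`); and the arithmetic `p/(q+1) ≤ (p − m)·S_1(q,m)` is `level_one_demand`
(`RankLevelSetHallLevelOneArith`).  The level-wise exchange of sums (`hallUp_level_of_ruleQLevel`, as in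
`hallUp_of_ruleQ`) turns the pointwise receipt into the Hall inequality for every `𝒜`.

* `ruleQRecvLevel` — Rule Q's receipt at a rank level; **`hallUp_level_of_ruleQLevel`** — the exchange of sums;
* `memCount_le_choose` — at the tight layer the members inside `S` number at most `C(#S, q)`;
* **`ruleQRecvLevel_one_ge`** — `(p − m)·S_1(q,m) ≤ recv_{q+1}(Z)`; `ruleQRecvLevel_one_ge_demand` — Rule Q pays
  the first level on every member;
* **`levelHallUp_first_of_ncard_eq`** — the theorem.
Axioms: standard.
-/

namespace PercRepro

open Set Matroid Finset

/-! ## Rule Q at a rank level, and the exchange of sums -/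

variable {α : Type} (M : Matroid α) [M.Finite]

open scoped Classical in
/-- **Rule Q's receipt at the rank level `t`**: `Σ_{S ∈ Y, r S = t, Z ⊆ S} 1/m(S)`. -/
noncomputable def ruleQRecvLevel (p q t : ℕ) (Z : Set α) : ℚ :=
  ∑ S ∈ (cellY_finite M p q).toFinset.filter (fun S => M.eRk S = (t : ℕ∞)),
    Set.indicator {S : Set α | Z ⊆ S} (fun S => 1 / (memCount M p q S : ℚ)) S

/-- **The exchange of sums at a level**: if every member receives at least `c` at the rank level `t` under
Rule Q, then every subfamily `𝒜` of members has at least `c·#𝒜` rank-`t` UP-neighbours. -/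
theorem hallUp_level_of_ruleQLevel (p q t : ℕ) (c : ℚ)
    (h : ∀ Z ∈ cellMembers M p q, c ≤ ruleQRecvLevel M p q t Z)
    (𝒜 : Set (Set α)) (h𝒜 : 𝒜 ⊆ cellMembers M p q) :
    c * (𝒜.ncard : ℚ) ≤ ({S ∈ upNbhd M p q 𝒜 | M.eRk S = (t : ℕ∞)}.ncard : ℚ) := by
  classical
  have h𝒜fin : 𝒜.Finite := (cellMembers_finite M p q).subset h𝒜
  set 𝒜f : Finset (Set α) := h𝒜fin.toFinset with h𝒜f
  set Yf : Finset (Set α) := (cellY_finite M p q).toFinset.filter (fun S => M.eRk S = (t : ℕ∞)) with hYf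
  have h𝒜card : (𝒜.ncard : ℚ) = (𝒜f.card : ℚ) := by
    rw [h𝒜f, ncard_eq_toFinset_card _ h𝒜fin]
  -- step 1: c·#𝒜 ≤ Σ_{Z ∈ 𝒜} recv_t(Z)
  have h1 : c * (𝒜f.card : ℚ) ≤ ∑ Z ∈ 𝒜f, ruleQRecvLevel M p q t Z := by
    rw [mul_comm, ← nsmul_eq_mul, ← Finset.sum_const]
    refine Finset.sum_le_sum (fun Z hZ => ?_)
    rw [h𝒜f, h𝒜fin.mem_toFinset] at hZ
    exact h Z (h𝒜 hZ)
  -- step 2: exchange the sums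
  have h2 : ∑ Z ∈ 𝒜f, ruleQRecvLevel M p q t Z =
      ∑ S ∈ Yf, ((𝒜f.filter (fun Z => Z ⊆ S)).card : ℚ) * (1 / (memCount M p q S : ℚ)) := by
    unfold ruleQRecvLevel
    rw [← hYf, Finset.sum_comm]
    refine Finset.sum_congr rfl (fun S _ => ?_)
    simp only [Set.indicator_apply, Set.mem_setOf_eq]
    rw [Finset.sum_ite, Finset.sum_const_zero, add_zero, Finset.sum_const, nsmul_eq_mul]
  -- step 3: each term is at most the indicator of «S contains a member of 𝒜»
  have h3 : ∀ S ∈ Yf, ((𝒜f.filter (fun Z => Z ⊆ S)).card : ℚ) * (1 / (memCount M p q S : ℚ)) ≤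
      (if ∃ Z ∈ 𝒜, Z ⊆ S then (1 : ℚ) else 0) := by
    intro S _
    by_cases hex : ∃ Z ∈ 𝒜, Z ⊆ S
    · rw [if_pos hex]
      have hle : (𝒜f.filter (fun Z => Z ⊆ S)).card ≤ memCount M p q S := by
        unfold memCount
        rw [← ncard_coe_finset]
        refine ncard_le_ncard ?_ ((cellMembers_finite M p q).subset (fun _ hZ => hZ.1))
        intro Z hZ
        rw [Finset.mem_coe, Finset.mem_filter, h𝒜f, h𝒜fin.mem_toFinset] at hZ
        exact ⟨h𝒜 hZ.1, hZ.2⟩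
      have hpos : 0 < memCount M p q S := by
        obtain ⟨Z, hZ, hZS⟩ := hex
        have : (𝒜f.filter (fun Z => Z ⊆ S)).card ≠ 0 := by
          rw [Finset.card_ne_zero]
          exact ⟨Z, Finset.mem_filter.2 ⟨by rw [h𝒜f, h𝒜fin.mem_toFinset]; exact hZ, hZS⟩⟩
        omega
      have hposq : (0 : ℚ) < (memCount M p q S : ℚ) := by exact_mod_cast hpos
      rw [mul_one_div, div_le_one hposq]
      exact_mod_cast hle
    · rw [if_neg hex]
      have hzero : (𝒜f.filter (fun Z => Z ⊆ S)).card = 0 := by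
        rw [Finset.card_eq_zero, Finset.filter_eq_empty_iff]
        intro Z hZ hZS
        rw [h𝒜f, h𝒜fin.mem_toFinset] at hZ
        exact hex ⟨Z, hZ, hZS⟩
      rw [hzero]
      simp
  -- step 4: the indicators sum to the size of the rank-t UP-neighbourhood
  have h4 : ∑ S ∈ Yf, (if ∃ Z ∈ 𝒜, Z ⊆ S then (1 : ℚ) else 0) =
      ({S ∈ upNbhd M p q 𝒜 | M.eRk S = (t : ℕ∞)}.ncard : ℚ) := by
    rw [Finset.sum_ite, Finset.sum_const_zero, add_zero, Finset.sum_const, nsmul_eq_mul, mul_one]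
    have hU : {S ∈ upNbhd M p q 𝒜 | M.eRk S = (t : ℕ∞)} =
        ((Yf.filter (fun S => ∃ Z ∈ 𝒜, Z ⊆ S) : Finset (Set α)) : Set (Set α)) := by
      ext S
      rw [Finset.coe_filter, hYf, Set.mem_setOf_eq, Set.mem_setOf_eq, Finset.mem_filter,
        (cellY_finite M p q).mem_toFinset]
      constructor
      · rintro ⟨⟨hSE, hq, hp, hex⟩, hr⟩
        exact ⟨⟨⟨hSE, hq, hp⟩, hr⟩, hex⟩
      · rintro ⟨⟨⟨hSE, hq, hp⟩, hr⟩, hex⟩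
        exact ⟨⟨hSE, hq, hp, hex⟩, hr⟩
    rw [hU, ncard_coe_finset]
  calc c * (𝒜.ncard : ℚ) = c * (𝒜f.card : ℚ) := by rw [h𝒜card]
    _ ≤ ∑ Z ∈ 𝒜f, ruleQRecvLevel M p q t Z := h1
    _ = ∑ S ∈ Yf, ((𝒜f.filter (fun Z => Z ⊆ S)).card : ℚ) * (1 / (memCount M p q S : ℚ)) := h2
    _ ≤ ∑ S ∈ Yf, (if ∃ Z ∈ 𝒜, Z ⊆ S then (1 : ℚ) else 0) := Finset.sum_le_sum h3
    _ = ({S ∈ upNbhd M p q 𝒜 | M.eRk S = (t : ℕ∞)}.ncard : ℚ) := h4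

/-! ## The first level: the Boolean split on `Z ∪ X_P ∪ {d}` -/

/-- **At the tight layer the members inside `S` number at most `C(#S, q)`** (they are `q`-subsets of `S`). -/
lemma memCount_le_choose {p q : ℕ} (hE : M.E.ncard = p + q) {S : Set α} (hS : S ⊆ M.E) :
    memCount M p q S ≤ S.ncard.choose q := by
  classical
  have hSfin : S.Finite := M.ground_finite.subset hS
  set Sf : Finset α := hSfin.toFinset with hSf
  have hScard : S.ncard = Sf.card := ncard_eq_toFinset_card _ hSfin
  unfold memCount
  have hsub : {Z' : Set α | Z' ∈ cellMembers M p q ∧ Z' ⊆ S} ⊆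
      (fun T : Finset α => (T : Set α)) '' ((Sf.powersetCard q : Finset (Finset α)) : Set (Finset α)) := by
    intro Z' hZ'
    obtain ⟨hZ'mem, hZ'S⟩ := hZ'
    have hZ'fin : Z'.Finite := hSfin.subset hZ'S
    refine ⟨hZ'fin.toFinset, ?_, by simp⟩
    rw [Finset.mem_coe, Finset.mem_powersetCard]
    refine ⟨?_, ?_⟩
    · intro x hx
      rw [hZ'fin.mem_toFinset] at hx
      rw [hSf, hSfin.mem_toFinset]
      exact hZ'S hx
    · rw [← ncard_eq_toFinset_card _ hZ'fin]
      exact ncard_eq_of_mem_cellMembers M hE hZ'mem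
  calc {Z' : Set α | Z' ∈ cellMembers M p q ∧ Z' ⊆ S}.ncard
      ≤ ((fun T : Finset α => (T : Set α)) '' ((Sf.powersetCard q : Finset (Finset α)) : Set (Finset α))).ncard :=
        ncard_le_ncard hsub ((Sf.powersetCard q).finite_toSet.image _)
    _ ≤ ((Sf.powersetCard q : Finset (Finset α)) : Set (Finset α)).ncard := ncard_image_le (Finset.finite_toSet _)
    _ = Sf.card.choose q := by rw [ncard_coe_finset, Finset.card_powersetCard]
    _ = S.ncard.choose q := by rw [hScard]

/-- **`recv_{q+1}(Z) ≥ (p − m)·S_1(q, m)`** for every member `Z` at the tight layer (`m = #flatPart Z`): the sets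
`Z ∪ X_P ∪ {d}` (`X_P ⊆ flatPart Z`, `d ∈ freePart Z`) are distinct sets of rank exactly `q + 1` above `Z`, each with
at most `C(q + #X_P + 1, q)` members inside, and there are `C(m, a)·(p − m)` of them with `#X_P = a`. -/
theorem ruleQRecvLevel_one_ge {p q : ℕ} (hE : M.E.ncard = p + q) (hpq : q + 2 ≤ p) {Z : Set α}
    (hZ : Z ∈ cellMembers M p q) :
    ((p : ℚ) - (flatPart M Z).ncard) * sliceS q (flatPart M Z).ncard 1 ≤ ruleQRecvLevel M p q (q + 1) Z := by
  classical
  have hPfin : (flatPart M Z).Finite := M.ground_finite.subset (fun x hx => hx.1.1)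
  have hDfin : (freePart M Z).Finite := M.ground_finite.subset (fun x hx => hx.1.1)
  set Pf := hPfin.toFinset with hPf
  set Df := hDfin.toFinset with hDf
  set m := (flatPart M Z).ncard with hm
  have hPcard : Pf.card = m := by rw [hPf, hm, ncard_eq_toFinset_card _ hPfin]
  have hDcard : Df.card = p - m := by
    rw [hDf, ← ncard_eq_toFinset_card _ hDfin]
    have := ncard_freePart_add_ncard_flatPart M hE hZ
    omega
  have hmp : m ≤ p := by
    have := ncard_freePart_add_ncard_flatPart M hE hZ
    omega
  have hZcard : Z.ncard = q := ncard_eq_of_mem_cellMembers M hE hZ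
  -- the pairs (X_P, d) and the index sets
  set Pairs : Finset (Finset α × α) := Pf.powerset ×ˢ Df with hPairs
  set g : Finset α × α → Set α := fun t => Z ∪ (↑t.1 : Set α) ∪ {t.2} with hg
  have hZP : Disjoint Z (flatPart M Z) := Set.disjoint_left.2 (fun x hx hx' => hx'.1.2 hx)
  have hZD : Disjoint Z (freePart M Z) := Set.disjoint_left.2 (fun x hx hx' => hx'.1.2 hx)
  have hPD : Disjoint (flatPart M Z) (freePart M Z) := Set.disjoint_left.2 (fun x hx hx' => hx'.2 hx.2)
  have hmemPairs : ∀ t ∈ Pairs, (↑t.1 : Set α) ⊆ flatPart M Z ∧ t.2 ∈ freePart M Z := by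
    intro t ht
    rw [hPairs, Finset.mem_product, Finset.mem_powerset] at ht
    refine ⟨?_, ?_⟩
    · intro x hx
      have := ht.1 hx
      rw [hPf, hPfin.mem_toFinset] at this
      exact this
    · have := ht.2
      rw [hDf, hDfin.mem_toFinset] at this
      exact this
  -- injectivity: X_P = g t ∩ P, {d} = g t ∩ D
  have hginj : Set.InjOn g Pairs := by
    intro t₁ ht₁ t₂ ht₂ hEq
    obtain ⟨hP₁, hD₁⟩ := hmemPairs t₁ (Finset.mem_coe.1 ht₁)
    obtain ⟨hP₂, hD₂⟩ := hmemPairs t₂ (Finset.mem_coe.1 ht₂)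
    simp only [hg] at hEq
    have hD₁' : ({t₁.2} : Set α) ⊆ freePart M Z := Set.singleton_subset_iff.2 hD₁
    have hD₂' : ({t₂.2} : Set α) ⊆ freePart M Z := Set.singleton_subset_iff.2 hD₂
    have e1 : (↑t₁.1 : Set α) = ↑t₂.1 := by
      have h : (Z ∪ (↑t₁.1 : Set α) ∪ {t₁.2}) ∩ flatPart M Z = (Z ∪ (↑t₂.1 : Set α) ∪ {t₂.2}) ∩ flatPart M Z := by
        rw [hEq]
      rw [Set.union_inter_distrib_right, Set.union_inter_distrib_right, hZP.inter_eq,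
        Set.inter_eq_left.2 hP₁, (hPD.symm.mono_left hD₁').inter_eq, Set.union_inter_distrib_right,
        Set.union_inter_distrib_right, hZP.inter_eq, Set.inter_eq_left.2 hP₂,
        (hPD.symm.mono_left hD₂').inter_eq] at h
      simpa using h
    have e2 : ({t₁.2} : Set α) = {t₂.2} := by
      have h : (Z ∪ (↑t₁.1 : Set α) ∪ {t₁.2}) ∩ freePart M Z = (Z ∪ (↑t₂.1 : Set α) ∪ {t₂.2}) ∩ freePart M Z := by
        rw [hEq]
      rw [Set.union_inter_distrib_right, Set.union_inter_distrib_right, hZD.inter_eq,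
        (hPD.mono_left hP₁).inter_eq, Set.inter_eq_left.2 hD₁', Set.union_inter_distrib_right,
        Set.union_inter_distrib_right, hZD.inter_eq, (hPD.mono_left hP₂).inter_eq,
        Set.inter_eq_left.2 hD₂'] at h
      simpa using h
    exact Prod.ext (Finset.coe_injective e1) (Set.singleton_injective e2)
  -- every index set is in Y, of rank exactly q + 1, above Z
  have hgY : ∀ t ∈ Pairs, g t ∈ cellY M p q ∧ M.eRk (g t) = ((q + 1 : ℕ) : ℕ∞) ∧ Z ⊆ g t := by
    intro t ht
    obtain ⟨hP, hD⟩ := hmemPairs t ht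
    have hsubE : g t ⊆ M.E := by
      simp only [hg]
      exact Set.union_subset (Set.union_subset hZ.1 (hP.trans (fun x hx => hx.1.1)))
        (Set.singleton_subset_iff.2 hD.1.1)
    have hdE : t.2 ∈ M.E \ M.closure Z := ⟨hD.1.1, hD.2⟩
    -- lower bound: r(g t) ≥ r(Z ∪ {d}) = q + 1
    have hlow : M.eRk (insert t.2 Z) = M.eRk Z + 1 := M.eRk_insert_eq_add_one hdE
    have hins : insert t.2 Z ⊆ g t := by
      intro x hx
      rcases hx with rfl | hx
      · exact Or.inr (Set.mem_singleton _)
      · exact Or.inl (Or.inl hx)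
    have h1 := M.eRk_mono hins
    rw [hlow, hZ.2.1] at h1
    -- upper bound: g t ⊆ cl Z ∪ {d}
    have hsub : g t ⊆ M.closure Z ∪ {t.2} := by
      intro x hx
      rcases hx with (hx | hx) | hx
      · exact Or.inl (M.subset_closure Z hZ.1 hx)
      · exact Or.inl (hP hx).2
      · exact Or.inr hx
    have h2 := M.eRk_mono hsub
    have h3 := M.eRk_union_le_eRk_add_encard (M.closure Z) ({t.2} : Set α)
    rw [M.eRk_closure_eq, hZ.2.1, Set.encard_singleton] at h3
    have hrk : M.eRk (g t) = ((q + 1 : ℕ) : ℕ∞) := by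
      push_cast
      exact le_antisymm (h2.trans h3) h1
    refine ⟨⟨hsubE, ?_, ?_⟩, hrk, fun x hx => Or.inl (Or.inl hx)⟩
    · rw [hrk]
      exact_mod_cast Nat.lt_succ_self q
    · rw [hrk]
      have hpq' : q + 1 < p := by omega
      exact_mod_cast hpq'
  -- the size of an index set: #(Z ∪ X_P ∪ {d}) = q + #X_P + 1
  have hcard_g : ∀ t ∈ Pairs, (g t).ncard = q + t.1.card + 1 := by
    intro t ht
    obtain ⟨hP, hD⟩ := hmemPairs t ht
    simp only [hg]
    have hfinP : ((↑t.1 : Set α)).Finite := Finset.finite_toSet _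
    have hfinZ : Z.Finite := M.ground_finite.subset hZ.1
    have hdisj1 : Disjoint Z (↑t.1 : Set α) := hZP.mono_right hP
    have hdisj2 : Disjoint (Z ∪ (↑t.1 : Set α)) ({t.2} : Set α) := by
      rw [Set.disjoint_singleton_right]
      intro hx
      rcases hx with hx | hx
      · exact Set.disjoint_left.1 hZD hx hD
      · exact Set.disjoint_left.1 hPD (hP hx) hD
    rw [Set.ncard_union_eq hdisj2 (hfinZ.union hfinP) (Set.finite_singleton _),
      Set.ncard_union_eq hdisj1 hfinZ hfinP, hZcard, Set.ncard_coe_finset, Set.ncard_singleton]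
  -- the bound on each index set: memCount(g t) ≤ C(q + #X_P + 1, q)
  have hbound : ∀ t ∈ Pairs, (1 : ℚ) / ((q + t.1.card + 1).choose q : ℚ) ≤ 1 / (memCount M p q (g t) : ℚ) := by
    intro t ht
    have h1 := memCount_le_choose M hE (hgY t ht).1.1
    rw [hcard_g t ht] at h1
    have h2 := one_le_memCount_of_subset M hZ (hgY t ht).2.2
    have hpos : (0 : ℚ) < (memCount M p q (g t) : ℚ) := by exact_mod_cast h2
    exact one_div_le_one_div_of_le hpos (by exact_mod_cast h1)
  -- assembly
  set F : Set α → ℚ := Set.indicator {S : Set α | Z ⊆ S} (fun S => 1 / (memCount M p q S : ℚ)) with hF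
  have hYsub : Pairs.image g ⊆
      (cellY_finite M p q).toFinset.filter (fun S => M.eRk S = ((q + 1 : ℕ) : ℕ∞)) := by
    intro S hS
    rw [Finset.mem_image] at hS
    obtain ⟨t, ht, rfl⟩ := hS
    rw [Finset.mem_filter, (cellY_finite M p q).mem_toFinset]
    exact ⟨(hgY t ht).1, (hgY t ht).2.1⟩
  have step1 : ∑ S ∈ Pairs.image g, F S ≤ ruleQRecvLevel M p q (q + 1) Z := by
    unfold ruleQRecvLevel
    refine Finset.sum_le_sum_of_subset_of_nonneg hYsub (fun S _ _ => ?_)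
    exact Set.indicator_nonneg (fun S _ => by positivity) S
  have step2 : ∑ S ∈ Pairs.image g, F S = ∑ t ∈ Pairs, 1 / (memCount M p q (g t) : ℚ) := by
    rw [Finset.sum_image hginj]
    refine Finset.sum_congr rfl (fun t ht => ?_)
    rw [hF, Set.indicator_of_mem]
    exact (hgY t ht).2.2
  have step3 : ∑ t ∈ Pairs, (1 : ℚ) / ((q + t.1.card + 1).choose q : ℚ) ≤
      ∑ t ∈ Pairs, 1 / (memCount M p q (g t) : ℚ) :=
    Finset.sum_le_sum hbound
  -- the sum over the pairs: Σ_{X_P ⊆ P} Σ_{d ∈ D} 1/C(q + #X_P + 1, q) = #D · Σ_a C(m, a)/C(q + 1 + a, a + 1)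
  have step4 : ∑ t ∈ Pairs, (1 : ℚ) / ((q + t.1.card + 1).choose q : ℚ) = ((p - m : ℕ) : ℚ) * sliceS q m 1 := by
    rw [hPairs, Finset.sum_product]
    simp only [Finset.sum_const, nsmul_eq_mul, hDcard]
    rw [← Finset.mul_sum]
    congr 1
    unfold sliceS
    rw [Finset.sum_powerset_apply_card (fun a => (1 : ℚ) / ((q + a + 1).choose q : ℚ)), hPcard]
    refine Finset.sum_congr rfl (fun a _ => ?_)
    have e : (q + a + 1).choose q = (q + 1 + a).choose (a + 1) := by
      rw [show q + a + 1 = q + (a + 1) by ring, Nat.choose_symm_add, show q + (a + 1) = q + 1 + a by ring]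
    rw [nsmul_eq_mul, mul_one_div, e]
  calc ((p : ℚ) - m) * sliceS q m 1 = ((p - m : ℕ) : ℚ) * sliceS q m 1 := by rw [Nat.cast_sub hmp]
    _ = ∑ t ∈ Pairs, (1 : ℚ) / ((q + t.1.card + 1).choose q : ℚ) := step4.symm
    _ ≤ ∑ t ∈ Pairs, 1 / (memCount M p q (g t) : ℚ) := step3
    _ = ∑ S ∈ Pairs.image g, F S := step2.symm
    _ ≤ ruleQRecvLevel M p q (q + 1) Z := step1

/-- **Rule Q pays the first level on every member at the tight layer**: `p/(q+1) ≤ recv_{q+1}(Z)`. -/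
theorem ruleQRecvLevel_one_ge_demand {p q : ℕ} (hE : M.E.ncard = p + q) (hpq : q + 2 ≤ p) {Z : Set α}
    (hZ : Z ∈ cellMembers M p q) : (p : ℚ) / ((q : ℚ) + 1) ≤ ruleQRecvLevel M p q (q + 1) Z := by
  have h1 := ruleQRecvLevel_one_ge M hE hpq hZ
  have h2 := level_one_demand p q (flatPart M Z).ncard hpq (ncard_flatPart_le M hE hZ)
  exact h2.trans h1

/-- **THE FIRST LEVEL OF THE LEVEL-WISE LYM FORM IS A THEOREM AT THE TIGHT LAYER**: for every finite matroid with
`#E = p + q`, `q + 2 ≤ p`, and every subfamily `𝒜` of members,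
`C(p+q, q+1)·#𝒜 ≤ C(p+q, q)·#{S ∈ upNbhd 𝒜 : r(S) = q + 1}` — the instance `t = q + 1` of `LevelHallUpC025`
(night-2's `ShadowC025Level`) at the tight layer. -/
theorem levelHallUp_first_of_ncard_eq (p q : ℕ) (hE : M.E.ncard = p + q) (hpq : q + 2 ≤ p)
    (𝒜 : Set (Set α)) (h𝒜 : 𝒜 ⊆ cellMembers M p q) :
    ((p + q).choose (q + 1) : ℚ) * (𝒜.ncard : ℚ) ≤
      ((p + q).choose q : ℚ) * ({S ∈ upNbhd M p q 𝒜 | M.eRk S = ((q + 1 : ℕ) : ℕ∞)}.ncard : ℚ) := by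
  have hH := hallUp_level_of_ruleQLevel M p q (q + 1) ((p : ℚ) / ((q : ℚ) + 1))
    (fun Z hZ => ruleQRecvLevel_one_ge_demand M hE hpq hZ) 𝒜 h𝒜
  have hc : ((p + q).choose (q + 1) : ℚ) * ((q : ℚ) + 1) = ((p + q).choose q : ℚ) * p := by
    have := Nat.choose_succ_right_eq (p + q) q
    rw [show p + q - q = p by omega] at this
    exact_mod_cast this
  have hq1 : (0 : ℚ) < (q : ℚ) + 1 := by positivity
  have hcpos : (0 : ℚ) ≤ ((p + q).choose q : ℚ) := by positivity
  rw [div_mul_eq_mul_div, div_le_iff₀ hq1] at hH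
  have hc' : ((p + q).choose (q + 1) : ℚ) = ((p + q).choose q : ℚ) * p / ((q : ℚ) + 1) := by
    rw [eq_div_iff hq1.ne']
    exact hc
  have key := mul_le_mul_of_nonneg_left hH hcpos
  rw [hc', div_mul_eq_mul_div, div_le_iff₀ hq1]
  calc ((p + q).choose q : ℚ) * (p : ℚ) * (𝒜.ncard : ℚ)
      = ((p + q).choose q : ℚ) * ((p : ℚ) * (𝒜.ncard : ℚ)) := by ring
    _ ≤ ((p + q).choose q : ℚ) *
          (({S ∈ upNbhd M p q 𝒜 | M.eRk S = ((q + 1 : ℕ) : ℕ∞)}.ncard : ℚ) * ((q : ℚ) + 1)) := key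
    _ = ((p + q).choose q : ℚ) * ({S ∈ upNbhd M p q 𝒜 | M.eRk S = ((q + 1 : ℕ) : ℕ∞)}.ncard : ℚ) *
          ((q : ℚ) + 1) := by ring

end PercRepro
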